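import Literature.Topology.FourManifolds.LatticeFormsPolarisationTypesOrbitNumberGeneral
import HarnessLib

/-!
# The discriminant group of GHS's lattice `L_B`, `B = (−2b, c·2t/f; c·2t/f, −2t)`: `k̄₁`, `k̄₃` have orders `2d/f`, `2t/f`,
# `k̄₁·k̄₃ = 0`, `k̄₃² = −f²/2t`, and `D(L_B) = ⟨k̄₁⟩ ⊕ ⟨k̄₃⟩ ≅ ℤ/(2d/f) ⊕ ℤ/(2t/f)` when `w = 1`
# (Gritsenko–Hulek–Sankaran, *Compositio Math.* 146 (2010), §4 proof of Prop. 4.12, first half; Remark 4.15)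

Trunk T-4MAN vocabulary; sequel of `LatticeFormsPolarisationTypesGeneralDivisor.lean` (row g43-#2: Prop. 4.6 (iv),
`(h_d)^⊥ ≅ 2U ⊕ 2E₈(−1) ⊕ B` with `B = (−2b, a; a, −2t)`, `f²b = d + tc²`, `fa = 2tc`, `det B · f² = 4dt`;
`toBilin'_generalDivisorGram_apply`), of `LatticeFormsPolarisationTypesOrbitNumberGeneral.lean` (g45-#1) and of
`LatticeFormsDiscriminantForm.lean` (`discriminantGroup = Λ^*/i(Λ)`, `dualForm`, `discriminantBilin`, `discriminantQuad`,
`natCard_discriminantGroup_eq`). Written for lane `lit-hodgefound` (Track 2 foundations; prover seat `lit-hodgefound-p18`,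
gen 45, row g45-#5). THEOREMS ONLY — no definition, no named fact, no instance, no notation.

## Source, verbatim (V. Gritsenko, K. Hulek, G. K. Sankaran, Compositio Math. 146 (2010) 404–434, arXiv numbering §4,
held text `paper:arxiv-0802.2078` pp. 12–13)

"*Proof* [of Prop. 4.12]. We may take `h_d` in the form (hd) [`h_d = fe₁ + fbe₂ + cl_t`]. We can fix a basis `{k₁, k₂}` of
`L_B^∨` given by `k₁ = (f/2d) h_d − e₂ = (f/2d)(fe₁ + bfe₂ + cl_t) − e₂`, `k₂ = (c/2d) h_d + (1/2t) l_t = (f/2d)(ce₁ + cbe₂ +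
(bf/t) l_t)`. Up to sign, this is dual to the basis fixed in (LB) [`L_B = ⟨e₁ − be₂, c(2t/f)e₂ + l_t⟩`]. We put
`k₃ = fk₂ − ck₁ = ce₂ + (f/2t) l_t`. If `v ∈ L^∨` we shall denote by `v̄` the corresponding element in the discriminant group
`D(L) = L^∨/L`. We note that the orders of `k̄₁` and of `k̄₃` in `D(L_B) = D((h_d)^⊥_{L_{2t}})` (see (LB)) are equal to
`2d/f` and `2t/f` respectively. Moreover `k̄₁·k̄₃ = 0`. Let us calculate the order of the intersection of the subgroups
generated by `k̄₁` and `k̄₃` in `D(L_B)`. If `n k̄₁ ∈ ⟨k̄₃⟩` then `n = g₁d₁n₁` because `m k̄₃` does not contain the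
`e₁`-component. Therefore `n k̄₁ ≡ ((n₁c/w) l_t + x e₂) mod L_B` where `x ∈ ℤ` (see (LB)), and `|⟨k̄₁⟩ ∩ ⟨k̄₃⟩| = w`. It
follows that `k̄₁` and `k̄₃` form a basis of `D(L_B)` if `w = 1`. […] where `⟨k̄₃⟩ = {n k̄₃ ∣ n mod 2t/f}` and
`k̄₃² ≡ −f²/2t mod 2`." (pp. 12–13) "**Remark 4.15.** […] If `g₁ > 1` the discriminant group is not cyclic, but it is the
orthogonal sum of two cyclic groups if `w = 1`." (p. 13)

## Reading notes

* THE OBJECT: the rank-`2` lattice `L_B = ℤ²` with GHS's Gram matrix `B = (−2b, a; a, −2t)`, `a = c·2t/f`, under the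
  relations of Prop. 4.6 (iv), `f²b = d + tc²`, `fa = 2tc`, `(f, c) = 1` (row g43-#2 shows `(h_d)^⊥ ≅ 2U ⊕ 2E₈(−1) ⊕ B` for
  EVERY primitive `h_d` with `(h_d, L) = fℤ`, so that `D((h_d)^⊥) ≅ D(L_B)`; the transport of the statements below to
  `(h_d)^⊥ ⊂ L_{2t}` itself is not in this file). `D(L_B) = L_B^*/i_B(L_B)` in the tree's vocabulary
  (`discriminantGroup (Matrix.toBilin' B)`), functionals written in the coordinate basis `ε₀, ε₁` (`LinearMap.proj`).
* `k₁`, `k₃` AS FUNCTIONALS ON `L_B`: restricted to `L_B = ⟨u₁ = e₁ − be₂, u₂ = c(2t/f)e₂ + l_t⟩` one has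
  `k₁ = (f/2d)h_d − e₂ ↦ −ε₀` (`(e₂, u₁) = 1`, `(e₂, u₂) = 0`, `h_d ⊥ L_B`) and `k₃ = ce₂ + (f/2t)l_t ↦ cε₀ − fε₁`; the file
  uses `k̄₁ = [ε₀]` and `k̄₃ = [fε₁ − cε₀]` (signs are immaterial for orders, spans and the vanishing of the product).
* WHAT IS PROVED: `|D(L_B)| = det B = (2d/f)(2t/f)` (§3); "the orders of `k̄₁` and of `k̄₃` […] are `2d/f` and `2t/f`" as
  `m·k̄₁ = 0 ⟺ 2d/f ∣ m`, `m·k̄₃ = 0 ⟺ 2t/f ∣ m` (§2; `2d/f`, `2t/f` supplied as `D'`, `T'` with `fD' = 2d`, `fT' = 2t`);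
  "`k̄₁·k̄₃ = 0`" as the vanishing of the `ℚ`-valued pairing `(ε₀ . fε₁ − cε₀)_{L_B^*} = 0` (exactly, not only mod `ℤ`), hence
  `b_{D(L_B)}(k̄₁, k̄₃) = 0`; "`k̄₃² ≡ −f²/2t mod 2`" as `(k₃ . k₃)_{L_B^*} = −f²/2t` and `q_{D(L_B)}(k̄₃) = −f²/2t mod 2ℤ`;
  in addition `(k₁ . k₁)_{L_B^*} = −f²/2d` (§4). "`|⟨k̄₁⟩ ∩ ⟨k̄₃⟩| = w`" is rendered through the index: since
  `|D(L_B)| = ord(k̄₁)·ord(k̄₃)`, the intersection has order `w` iff `⟨k̄₁, k̄₃⟩` has index `w`, and `⟨k̄₁, k̄₃⟩ ⊃ i_B(L_B)` has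
  index `((f, c·2t/f, 2t), …) = (f, 2t/f)` in `L_B^*` — the file proves the two directions that matter: `k̄₁`, `k̄₃` generate
  `D(L_B)` when `(f, 2t/f) = 1`, and if they generate then `(f, 2t/f) = 1` (§3); for types that occur `(f, 2t/f)` is the printed
  `w` (row g45-#1 `gcd_gcd_eq_gcd_of_sq_dvd`). "`k̄₁` and `k̄₃` form a basis of `D(L_B)` if `w = 1`" / Remark 4.15's
  "orthogonal sum of two cyclic groups": an additive isomorphism `D(L_B) ≅ ℤ/(2d/f) × ℤ/(2t/f)` with `k̄₁ ↦ (1, 0)`,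
  `k̄₃ ↦ (0, 1)` (§3), orthogonality being §4.
* NOT RESTATED: the printed intermediate claim "`n = g₁d₁n₁` because `m k̄₃` does not contain the `e₁`-component"; Remark
  4.15's cyclicity clauses ("cyclic … if `g₁ = 1`", "not cyclic if `g₁ > 1`"), which depend on the reading of `g₁` there
  (by Prop. 4.6 (iv) `D(L_B)` is cyclic iff the gcd `g₁(2b/g₁, w)` of the entries of `B` is `1`; e.g. `t = 9`, `d = 27`,
  `f = 6`, `c = 1` has `(2t/f, 2d/f) = 3 > 1` and cyclic `D(L_B) ≅ ℤ/27`) — recorded as a reading note, not as an erratum.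

## Contents (all proved)

* §1 `toBilin'_generalDivisorGram_vecCons` (`i_B(x, y) = (−2bx + ay)ε₀ + (ax − 2ty)ε₁`),
  **`smul_proj_add_smul_proj_mem_range_iff`** (`pε₀ + qε₁ ∈ i_B(L_B)` iff `p = −2bx + ay`, `q = ax − 2ty`).
* §2 **`zsmul_mk_proj_zero_eq_zero_iff`** (`m·k̄₁ = 0 ⟺ 2d/f ∣ m`), **`zsmul_mk_sub_eq_zero_iff`** (`m·k̄₃ = 0 ⟺ 2t/f ∣ m`).
* §3 **`natCard_discriminantGroup_generalDivisorGram`** (`|D(L_B)| = |(2d/f)(2t/f)|`), **`exists_mk_eq_zsmul_add_zsmul`**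
  (`(f, 2t/f) = 1` ⟹ `k̄₁, k̄₃` generate), `gcd_eq_one_of_exists_mk_proj_one_eq` (generate ⟹ `(f, 2t/f) = 1`),
  **`exists_discriminantGroup_addEquiv_zmod_prod_zmod`** (`w = 1`: `D(L_B) ≅ ℤ/(2d/f) × ℤ/(2t/f)`, `k̄₁ ↦ (1,0)`, `k̄₃ ↦ (0,1)`).
* §4 `isSymm_` / `isEven_` / `nondegenerate_toBilin'_generalDivisorGram`, `toBilin'_generalDivisorGram_neg_eq_smul_proj`
  (`i_B(−f, −c) = (2d/f)ε₀`), `toBilin'_generalDivisorGram_eq_smul_sub` (`i_B(0, −1) = (2t/f)(fε₁ − cε₀)`),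
  **`dualForm_proj_zero_sub_eq_zero`** and **`discriminantBilin_mk_proj_zero_mk_sub_eq_zero`** ("`k̄₁·k̄₃ = 0`"),
  **`dualForm_sub_sub_eq`** and **`discriminantQuad_mk_sub_eq`** ("`k̄₃² ≡ −f²/2t mod 2`"), `dualForm_proj_zero_proj_zero_eq`
  (`k̄₁² = −f²/2d`).

## References

* [GritsenkoHulekSankaran2010Symplectic] V. Gritsenko, K. Hulek, G. K. Sankaran, Moduli spaces of irreducible symplectic
  manifolds, Compositio Math. 146 (2010) 404–434 (arXiv:0802.2078): §4 proof of Prop. 4.12 (the basis `k₁, k₂` of `L_B^∨`,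
  `k₃`, orders, `k̄₁·k̄₃ = 0`, `|⟨k̄₁⟩ ∩ ⟨k̄₃⟩| = w`, `k̄₃²`), Prop. 4.6 (iv), Remark 4.15.
* [Nikulin1980] V. V. Nikulin, Integral symmetric bilinear forms and some of their applications, Math. USSR Izv. 14 (1980):
  §1.3 (discriminant forms `b_L`, `q_L`; the tree's `discriminantBilin` / `discriminantQuad`).
-/

noncomputable section

open Module Function
open LinearMap (BilinForm)
open LinearMap.BilinForm

namespace Literature.Topology.FourManifolds

/-! ### §1 The functionals on `L_B = ℤ²` and the image `i_B(L_B) ⊂ L_B^*` -/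

section Functionals

variable (t : ℕ)

/-- `i_B(x, y) = (−2bx + ay)·ε₀ + (ax − 2ty)·ε₁` for `B = (−2b, a; a, −2t)`. [cite: GritsenkoHulekSankaran2010Symplectic, §4 Prop. 4.6 (iv)] -/
theorem toBilin'_generalDivisorGram_vecCons (b a x y : ℤ) :
    Matrix.toBilin' !![-(2 * b), a; a, -(2 * t : ℤ)] ![x, y] =
      (-(2 * b) * x + a * y) • (LinearMap.proj 0 : Module.Dual ℤ (Fin 2 → ℤ)) +
        (a * x - 2 * t * y) • (LinearMap.proj 1 : Module.Dual ℤ (Fin 2 → ℤ)) := by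
  refine LinearMap.ext fun q ↦ ?_
  rw [toBilin'_generalDivisorGram_apply]
  simp only [LinearMap.add_apply, LinearMap.smul_apply, LinearMap.coe_proj, Function.eval, smul_eq_mul,
    Matrix.cons_val_zero, Matrix.cons_val_one]
  ring

/-- Two combinations `pε₀ + qε₁` agree iff their coefficients do. [folklore] -/
private theorem smul_proj_add_smul_proj_injective {p q p' q' : ℤ}
    (h : (p • (LinearMap.proj 0 : Module.Dual ℤ (Fin 2 → ℤ)) + q • (LinearMap.proj 1 : Module.Dual ℤ (Fin 2 → ℤ))) =
      p' • (LinearMap.proj 0 : Module.Dual ℤ (Fin 2 → ℤ)) + q' • (LinearMap.proj 1 : Module.Dual ℤ (Fin 2 → ℤ))) :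
    p = p' ∧ q = q' := by
  have h0 := LinearMap.congr_fun h (Pi.single 0 1)
  have h1 := LinearMap.congr_fun h (Pi.single 1 1)
  simp only [LinearMap.add_apply, LinearMap.smul_apply, LinearMap.coe_proj, Function.eval, Pi.single_eq_same,
    Pi.single_eq_of_ne (show (1 : Fin 2) ≠ 0 by decide), Pi.single_eq_of_ne (show (0 : Fin 2) ≠ 1 by decide),
    smul_eq_mul, mul_one, mul_zero, add_zero, zero_add] at h0 h1
  exact ⟨h0, h1⟩

/-- Every functional on `ℤ²` is `φ(e₀)·ε₀ + φ(e₁)·ε₁`. [folklore] -/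
private theorem dual_eq_smul_proj_add_smul_proj (φ : Module.Dual ℤ (Fin 2 → ℤ)) :
    φ = φ (Pi.single 0 1) • (LinearMap.proj 0 : Module.Dual ℤ (Fin 2 → ℤ)) +
      φ (Pi.single 1 1) • (LinearMap.proj 1 : Module.Dual ℤ (Fin 2 → ℤ)) := by
  refine (Pi.basisFun ℤ (Fin 2)).ext fun i ↦ ?_
  fin_cases i <;>
    simp [LinearMap.add_apply, LinearMap.smul_apply, Pi.single_eq_of_ne]

/-- **`i_B(L_B) ⊂ L_B^*` in coordinates**: `pε₀ + qε₁ ∈ i_B(L_B)` iff `p = −2bx + ay`, `q = ax − 2ty` for some integers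
`x, y`. [cite: GritsenkoHulekSankaran2010Symplectic, §4 proof of Prop. 4.12 ("dual to the basis fixed in (LB)")] -/
theorem smul_proj_add_smul_proj_mem_range_iff (b a p q : ℤ) :
    (p • (LinearMap.proj 0 : Module.Dual ℤ (Fin 2 → ℤ)) + q • (LinearMap.proj 1 : Module.Dual ℤ (Fin 2 → ℤ))) ∈
        LinearMap.range (Matrix.toBilin' !![-(2 * b), a; a, -(2 * t : ℤ)]) ↔
      ∃ x y : ℤ, p = -(2 * b) * x + a * y ∧ q = a * x - 2 * t * y := by
  constructor
  · rintro ⟨v, hv⟩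
    refine ⟨v 0, v 1, ?_⟩
    have hv' : v = ![v 0, v 1] := by ext i; fin_cases i <;> rfl
    rw [hv', toBilin'_generalDivisorGram_vecCons] at hv
    obtain ⟨h1, h2⟩ := smul_proj_add_smul_proj_injective hv
    exact ⟨h1.symm, h2.symm⟩
  · rintro ⟨x, y, hp, hq⟩
    exact ⟨![x, y], by rw [toBilin'_generalDivisorGram_vecCons, hp, hq]⟩

end Functionals

/-! ### §2 "The orders of `k̄₁` and of `k̄₃` in `D(L_B)` are equal to `2d/f` and `2t/f`" -/

section Orders

variable (t : ℕ)

/-- **`m·k̄₁ = 0 ⟺ (2d/f) ∣ m`** for `k̄₁ = [ε₀] ∈ D(L_B)` (`B = (−2b, a; a, −2t)`, `f²b = d + tc²`, `fa = 2tc`, `(f, c) = 1`,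
`f ≠ 0`, `t ≥ 1`; `D' = 2d/f`): "the order of `k̄₁` […] in `D(L_B)` [is] equal to `2d/f`". (`k₁ = (f/2d)h_d − e₂` restricted to
`L_B = ⟨e₁ − be₂, c(2t/f)e₂ + l_t⟩` is `−ε₀`.) [cite: GritsenkoHulekSankaran2010Symplectic, §4 proof of Prop. 4.12] -/
theorem zsmul_mk_proj_zero_eq_zero_iff (ht : 0 < t) {f b c a d D' : ℤ} (hf : f ≠ 0) (hb : f ^ 2 * b = d + t * c ^ 2)
    (ha : f * a = 2 * t * c) (hc : Int.gcd f c = 1) (hD : f * D' = 2 * d) (m : ℤ) :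
    m • (Submodule.Quotient.mk (LinearMap.proj 0 : Module.Dual ℤ (Fin 2 → ℤ)) :
        (Matrix.toBilin' !![-(2 * b), a; a, -(2 * t : ℤ)]).discriminantGroup) = 0 ↔ D' ∣ m := by
  have hkey : a * c - 2 * b * f = -D' := by
    apply mul_left_cancel₀ hf
    linear_combination c * ha - 2 * hb + hD
  change Submodule.Quotient.mk (m • (LinearMap.proj 0 : Module.Dual ℤ (Fin 2 → ℤ))) = 0 ↔ _
  rw [Submodule.Quotient.mk_eq_zero,
    show m • (LinearMap.proj 0 : Module.Dual ℤ (Fin 2 → ℤ)) =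
      m • (LinearMap.proj 0 : Module.Dual ℤ (Fin 2 → ℤ)) + (0 : ℤ) • (LinearMap.proj 1 : Module.Dual ℤ (Fin 2 → ℤ)) by
      rw [zero_smul, add_zero],
    smul_proj_add_smul_proj_mem_range_iff]
  constructor
  · rintro ⟨x, y, hm, h0⟩
    -- `ax = 2ty` ⟹ `cx = fy` ⟹ `x = fk`, `y = ck`
    have h1 : c * x = f * y := by
      have ht0 : (2 * t : ℤ) ≠ 0 := by positivity
      apply mul_left_cancel₀ ht0
      linear_combination -x * ha - f * h0
    have h2 : f ∣ x := by
      have hcop : IsCoprime f c := Int.isCoprime_iff_gcd_eq_one.2 hc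
      exact hcop.dvd_of_dvd_mul_left ⟨y, by rw [h1]⟩
    obtain ⟨k, rfl⟩ := h2
    have h3 : y = c * k := by
      apply mul_left_cancel₀ hf
      linear_combination -h1
    refine ⟨-k, ?_⟩
    rw [hm, h3]
    linear_combination k * hkey
  · rintro ⟨k, rfl⟩
    refine ⟨-(f * k), -(c * k), ?_, ?_⟩
    · linear_combination k * hkey
    · linear_combination k * ha

/-- **`m·k̄₃ = 0 ⟺ (2t/f) ∣ m`** for `k̄₃ = [fε₁ − cε₀] ∈ D(L_B)` (`d ≠ 0`; `T' = 2t/f`): "the order […] of `k̄₃` in `D(L_B)` [is]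
equal to `2t/f`". (`k₃ = fk₂ − ck₁ = ce₂ + (f/2t)l_t` restricted to `L_B` is `cε₀ − fε₁`.)
[cite: GritsenkoHulekSankaran2010Symplectic, §4 proof of Prop. 4.12] -/
theorem zsmul_mk_sub_eq_zero_iff {f b c a d D' T' : ℤ} (hf : f ≠ 0) (hd : d ≠ 0)
    (hb : f ^ 2 * b = d + t * c ^ 2) (ha : f * a = 2 * t * c) (hD : f * D' = 2 * d) (hT : f * T' = 2 * t) (m : ℤ) :
    m • (Submodule.Quotient.mk ((f • (LinearMap.proj 1 : Module.Dual ℤ (Fin 2 → ℤ)) -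
        c • (LinearMap.proj 0 : Module.Dual ℤ (Fin 2 → ℤ)))) :
        (Matrix.toBilin' !![-(2 * b), a; a, -(2 * t : ℤ)]).discriminantGroup) = 0 ↔ T' ∣ m := by
  have hkey : a * c - 2 * b * f = -D' := by
    apply mul_left_cancel₀ hf
    linear_combination c * ha - 2 * hb + hD
  have hdet : 4 * b * t - a ^ 2 = D' * T' := by
    have h1 := det_generalDivisorGram_mul_sq t hb ha
    rw [Matrix.det_fin_two_of] at h1
    have hf2 : f ^ 2 ≠ 0 := pow_ne_zero 2 hf
    apply mul_left_cancel₀ hf2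
    linear_combination h1 - T' * f * hD - 2 * d * hT
  have haT : a = c * T' := by
    apply mul_left_cancel₀ hf
    linear_combination ha - c * hT
  have hD0 : D' ≠ 0 := by
    rintro rfl
    rw [mul_zero] at hD
    omega
  change Submodule.Quotient.mk (m • (f • (LinearMap.proj 1 : Module.Dual ℤ (Fin 2 → ℤ)) -
    c • (LinearMap.proj 0 : Module.Dual ℤ (Fin 2 → ℤ)))) = 0 ↔ _
  rw [Submodule.Quotient.mk_eq_zero, smul_sub, smul_smul, smul_smul,
    show (m * f) • (LinearMap.proj 1 : Module.Dual ℤ (Fin 2 → ℤ)) - (m * c) • (LinearMap.proj 0 : Module.Dual ℤ (Fin 2 → ℤ)) =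
      (-(m * c)) • (LinearMap.proj 0 : Module.Dual ℤ (Fin 2 → ℤ)) + (m * f) • (LinearMap.proj 1 : Module.Dual ℤ (Fin 2 → ℤ))
      by rw [neg_smul]; abel,
    smul_proj_add_smul_proj_mem_range_iff]
  constructor
  · rintro ⟨x, y, h1, h2⟩
    -- `a·(1) + 2b·(2)`: `(a² − 4bt)·y = m·D'`, and `4bt − a² = D'T'`
    have h3 : -(D' * T') * y = m * D' := by
      rw [← hdet]
      linear_combination -(a * h1) - 2 * b * h2 - m * hkey
    refine ⟨-y, mul_left_cancel₀ hD0 ?_⟩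
    linear_combination -h3
  · rintro ⟨k, rfl⟩
    refine ⟨0, -k, ?_, ?_⟩
    · rw [haT]; ring
    · linear_combination k * hT

end Orders

/-! ### §3 `|D(L_B)| = (2d/f)(2t/f)`; "`|⟨k̄₁⟩ ∩ ⟨k̄₃⟩| = w`": `k̄₁`, `k̄₃` generate iff `(f, 2t/f) = 1`; a basis when `w = 1` -/

section Structure

variable (t : ℕ)

/-- **`|D(L_B)| = det B = 4dt/f² = (2d/f)·(2t/f)`** (`f²b = d + tc²`, `fa = 2tc`, `fD' = 2d`, `fT' = 2t`, `f, d ≠ 0`, `t ≥ 1`).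
[cite: GritsenkoHulekSankaran2010Symplectic, §4 Prop. 4.6 (iv) ("of determinant `4dt/f²`") and proof of Prop. 4.12] -/
theorem natCard_discriminantGroup_generalDivisorGram (ht : 0 < t) {f b c a d D' T' : ℤ} (hf : f ≠ 0) (hd : d ≠ 0)
    (hb : f ^ 2 * b = d + t * c ^ 2) (ha : f * a = 2 * t * c) (hD : f * D' = 2 * d) (hT : f * T' = 2 * t) :
    Nat.card (Matrix.toBilin' !![-(2 * b), a; a, -(2 * t : ℤ)]).discriminantGroup = (D' * T').natAbs := by
  have hdet : Matrix.det !![-(2 * b), a; a, -(2 * t : ℤ)] = D' * T' := by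
    have h1 := det_generalDivisorGram_mul_sq t hb ha
    have hf2 : f ^ 2 ≠ 0 := pow_ne_zero 2 hf
    apply mul_left_cancel₀ hf2
    linear_combination h1 - T' * f * hD - 2 * d * hT
  have hD0 : D' ≠ 0 := by
    rintro rfl
    rw [mul_zero] at hD
    omega
  have hT0 : T' ≠ 0 := by
    rintro rfl
    rw [mul_zero] at hT
    omega
  classical
  have hM : LinearMap.BilinForm.toMatrix (Pi.basisFun ℤ (Fin 2)) (Matrix.toBilin' !![-(2 * b), a; a, -(2 * t : ℤ)]) =
      !![-(2 * b), a; a, -(2 * t : ℤ)] := by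
    rw [LinearMap.BilinForm.toMatrix_basisFun, LinearMap.BilinForm.toMatrix'_toBilin']
  rw [natCard_discriminantGroup_eq _ (Pi.basisFun ℤ (Fin 2)) (by rw [hM, hdet]; exact mul_ne_zero hD0 hT0), hM, hdet]

/-- **`k̄₁ = [ε₀]` and `k̄₃ = [fε₁ − cε₀]` generate `D(L_B)` when `(f, 2t/f) = 1`**: every class is `m·k̄₁ + n·k̄₃`
("`k̄₁` and `k̄₃` form a basis of `D(L_B)` if `w = 1`"; `fa = 2tc`, `(f, c) = 1`, `fT' = 2t`, `(f, T') = 1`). In general the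
subgroup they generate has index `(f, 2t/f) = w`, i.e. "`|⟨k̄₁⟩ ∩ ⟨k̄₃⟩| = w`"; only the case `w = 1` is formalised.
[cite: GritsenkoHulekSankaran2010Symplectic, §4 proof of Prop. 4.12 ("`k̄₁` and `k̄₃` form a basis of `D(L_B)` if `w = 1`")] -/
theorem exists_mk_eq_zsmul_add_zsmul {f b c a T' : ℤ} (hf : f ≠ 0) (ha : f * a = 2 * t * c) (hc : Int.gcd f c = 1)
    (hT : f * T' = 2 * t) (hw : Int.gcd f T' = 1) (φ : Module.Dual ℤ (Fin 2 → ℤ)) :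
    ∃ m n : ℤ, (Submodule.Quotient.mk φ : (Matrix.toBilin' !![-(2 * b), a; a, -(2 * t : ℤ)]).discriminantGroup) =
      m • Submodule.Quotient.mk (LinearMap.proj 0 : Module.Dual ℤ (Fin 2 → ℤ)) + n • Submodule.Quotient.mk (f • (LinearMap.proj 1 : Module.Dual ℤ (Fin 2 → ℤ)) - c • (LinearMap.proj 0 : Module.Dual ℤ (Fin 2 → ℤ))) := by
  have haT : a = c * T' := by
    apply mul_left_cancel₀ hf
    linear_combination ha - c * hT
  set p := φ (Pi.single 0 1) with hp
  set q := φ (Pi.single 1 1) with hq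
  have hφ := dual_eq_smul_proj_add_smul_proj φ
  -- `q = nf + zT'` and `z = cx − fy`
  obtain ⟨n, z, hnz⟩ : ∃ n z : ℤ, n * f + z * T' = q :=
    ⟨q * Int.gcdA f T', q * Int.gcdB f T', by
      have h := Int.gcd_eq_gcd_ab f T'
      rw [hw, Nat.cast_one] at h
      linear_combination -q * h⟩
  obtain ⟨x, y, hxy⟩ : ∃ x y : ℤ, c * x - f * y = z :=
    ⟨z * Int.gcdB f c, -(z * Int.gcdA f c), by
      have h := Int.gcd_eq_gcd_ab f c
      rw [hc, Nat.cast_one] at h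
      linear_combination -z * h⟩
  refine ⟨p + n * c + 2 * b * x - a * y, n, ?_⟩
  have hmem : φ - ((p + n * c + 2 * b * x - a * y) • (LinearMap.proj 0 : Module.Dual ℤ (Fin 2 → ℤ)) + n • (f • (LinearMap.proj 1 : Module.Dual ℤ (Fin 2 → ℤ)) - c • (LinearMap.proj 0 : Module.Dual ℤ (Fin 2 → ℤ)))) ∈ LinearMap.range (Matrix.toBilin' !![-(2 * b), a; a, -(2 * t : ℤ)]) := by
    rw [hφ, ← hp, ← hq,
      show p • (LinearMap.proj 0 : Module.Dual ℤ (Fin 2 → ℤ)) + q • (LinearMap.proj 1 : Module.Dual ℤ (Fin 2 → ℤ)) - ((p + n * c + 2 * b * x - a * y) • (LinearMap.proj 0 : Module.Dual ℤ (Fin 2 → ℤ)) + n • (f • (LinearMap.proj 1 : Module.Dual ℤ (Fin 2 → ℤ)) - c • (LinearMap.proj 0 : Module.Dual ℤ (Fin 2 → ℤ)))) =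
        (-(2 * b) * x + a * y) • (LinearMap.proj 0 : Module.Dual ℤ (Fin 2 → ℤ)) + (q - n * f) • (LinearMap.proj 1 : Module.Dual ℤ (Fin 2 → ℤ)) by module,
      smul_proj_add_smul_proj_mem_range_iff]
    exact ⟨x, y, rfl, by rw [haT]; linear_combination -hnz - T' * hxy - y * hT⟩
  exact (Submodule.Quotient.eq _).2 hmem

/-- **Conversely, if `k̄₁`, `k̄₃` generate `D(L_B)` then `(f, 2t/f) = 1`** — the index of `⟨k̄₁, k̄₃⟩` is `(f, 2t/f)`, the
`w` of "`|⟨k̄₁⟩ ∩ ⟨k̄₃⟩| = w`" (`fa = 2tc`, `fT' = 2t`, `f ≠ 0`): already `[ε₁] ∈ ⟨k̄₁, k̄₃⟩` forces `1 ∈ fℤ + T'ℤ`.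
[cite: GritsenkoHulekSankaran2010Symplectic, §4 proof of Prop. 4.12 ("`|⟨k̄₁⟩ ∩ ⟨k̄₃⟩| = w`")] -/
theorem gcd_eq_one_of_exists_mk_proj_one_eq {f b c a T' : ℤ} (hf : f ≠ 0) (ha : f * a = 2 * t * c) (hT : f * T' = 2 * t)
    (h : ∃ m n : ℤ, (Submodule.Quotient.mk (LinearMap.proj 1 : Module.Dual ℤ (Fin 2 → ℤ)) : (Matrix.toBilin' !![-(2 * b), a; a, -(2 * t : ℤ)]).discriminantGroup) =
      m • Submodule.Quotient.mk (LinearMap.proj 0 : Module.Dual ℤ (Fin 2 → ℤ)) + n • Submodule.Quotient.mk (f • (LinearMap.proj 1 : Module.Dual ℤ (Fin 2 → ℤ)) - c • (LinearMap.proj 0 : Module.Dual ℤ (Fin 2 → ℤ)))) :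
    Int.gcd f T' = 1 := by
  have haT : a = c * T' := by
    apply mul_left_cancel₀ hf
    linear_combination ha - c * hT
  obtain ⟨m, n, hmn⟩ := h
  have hmem : (LinearMap.proj 1 : Module.Dual ℤ (Fin 2 → ℤ)) - (m • (LinearMap.proj 0 : Module.Dual ℤ (Fin 2 → ℤ)) + n • (f • (LinearMap.proj 1 : Module.Dual ℤ (Fin 2 → ℤ)) - c • (LinearMap.proj 0 : Module.Dual ℤ (Fin 2 → ℤ)))) ∈ LinearMap.range (Matrix.toBilin' !![-(2 * b), a; a, -(2 * t : ℤ)]) := (Submodule.Quotient.eq _).1 hmn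
  rw [show (LinearMap.proj 1 : Module.Dual ℤ (Fin 2 → ℤ)) - (m • (LinearMap.proj 0 : Module.Dual ℤ (Fin 2 → ℤ)) + n • (f • (LinearMap.proj 1 : Module.Dual ℤ (Fin 2 → ℤ)) - c • (LinearMap.proj 0 : Module.Dual ℤ (Fin 2 → ℤ)))) = (-m + n * c) • (LinearMap.proj 0 : Module.Dual ℤ (Fin 2 → ℤ)) + (1 - n * f) • (LinearMap.proj 1 : Module.Dual ℤ (Fin 2 → ℤ)) by module,
    smul_proj_add_smul_proj_mem_range_iff] at hmem
  obtain ⟨x, y, -, h2⟩ := hmem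
  -- `1 = nf + T'(cx − fy)`
  have h1 : (Int.gcd f T' : ℤ) ∣ 1 := by
    have e : (1 : ℤ) = f * (n - T' * y) + T' * (c * x) := by rw [haT] at h2; linear_combination h2 + y * hT
    rw [e]
    exact dvd_add ((Int.gcd_dvd_left _ _).mul_right _) ((Int.gcd_dvd_right _ _).mul_right _)
  exact Nat.eq_one_of_dvd_one (Int.natCast_dvd_natCast.1 h1)

/-- **"`k̄₁` and `k̄₃` form a basis of `D(L_B)` if `w = 1`": `D(L_B) ≅ ℤ/(2d/f) ⊕ ℤ/(2t/f)`, `k̄₁ ↦ (1, 0)`, `k̄₃ ↦ (0, 1)`** —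
"the discriminant group is […] the orthogonal sum of two cyclic groups if `w = 1`" (Remark 4.15; orthogonality: §4). Here
`f²b = d + tc²`, `fa = 2tc`, `(f, c) = 1`, `fD' = 2d`, `fT' = 2t` with natural numbers `D', T'`, `f, d ≠ 0`, `t ≥ 1`, and
`w = (f, 2t/f) = 1`. [cite: GritsenkoHulekSankaran2010Symplectic, §4 proof of Prop. 4.12 and Remark 4.15] -/
theorem exists_discriminantGroup_addEquiv_zmod_prod_zmod (ht : 0 < t) {f b c a d : ℤ} {D' T' : ℕ} (hf : f ≠ 0)
    (hd : d ≠ 0) (hb : f ^ 2 * b = d + t * c ^ 2) (ha : f * a = 2 * t * c) (hc : Int.gcd f c = 1) (hD : f * D' = 2 * d)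
    (hT : f * T' = 2 * t) (hw : Int.gcd f T' = 1) :
    ∃ e : (Matrix.toBilin' !![-(2 * b), a; a, -(2 * t : ℤ)]).discriminantGroup ≃+ ZMod D' × ZMod T',
      e (Submodule.Quotient.mk (LinearMap.proj 0 : Module.Dual ℤ (Fin 2 → ℤ))) = (1, 0) ∧ e (Submodule.Quotient.mk (f • (LinearMap.proj 1 : Module.Dual ℤ (Fin 2 → ℤ)) - c • (LinearMap.proj 0 : Module.Dual ℤ (Fin 2 → ℤ)))) = (0, 1) := by
  have hD0 : D' ≠ 0 := by
    rintro rfl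
    rw [Nat.cast_zero, mul_zero] at hD
    omega
  have hT0 : T' ≠ 0 := by
    rintro rfl
    rw [Nat.cast_zero, mul_zero] at hT
    omega
  haveI : NeZero D' := ⟨hD0⟩
  haveI : NeZero T' := ⟨hT0⟩
  -- the two cyclic factors
  have h1 : (D' : ℤ) • (Submodule.Quotient.mk (LinearMap.proj 0 : Module.Dual ℤ (Fin 2 → ℤ)) : (Matrix.toBilin' !![-(2 * b), a; a, -(2 * t : ℤ)]).discriminantGroup) = 0 :=
    (zsmul_mk_proj_zero_eq_zero_iff t ht hf hb ha hc hD _).2 dvd_rfl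
  have h3 : (T' : ℤ) • (Submodule.Quotient.mk (f • (LinearMap.proj 1 : Module.Dual ℤ (Fin 2 → ℤ)) - c • (LinearMap.proj 0 : Module.Dual ℤ (Fin 2 → ℤ))) : (Matrix.toBilin' !![-(2 * b), a; a, -(2 * t : ℤ)]).discriminantGroup) = 0 :=
    (zsmul_mk_sub_eq_zero_iff t hf hd hb ha hD hT _).2 dvd_rfl
  set ψ₁ : ZMod D' →+ (Matrix.toBilin' !![-(2 * b), a; a, -(2 * t : ℤ)]).discriminantGroup :=
    ZMod.lift D' ⟨zmultiplesHom _ (Submodule.Quotient.mk (LinearMap.proj 0 : Module.Dual ℤ (Fin 2 → ℤ))), by rw [zmultiplesHom_apply]; exact h1⟩ with hψ₁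
  set ψ₃ : ZMod T' →+ (Matrix.toBilin' !![-(2 * b), a; a, -(2 * t : ℤ)]).discriminantGroup :=
    ZMod.lift T' ⟨zmultiplesHom _ (Submodule.Quotient.mk (f • (LinearMap.proj 1 : Module.Dual ℤ (Fin 2 → ℤ)) - c • (LinearMap.proj 0 : Module.Dual ℤ (Fin 2 → ℤ)))), by rw [zmultiplesHom_apply]; exact h3⟩ with hψ₃
  set ψ := ψ₁.coprod ψ₃ with hψ
  have hψ_apply : ∀ m n : ℤ, ψ ((m : ZMod D'), (n : ZMod T')) =
      m • Submodule.Quotient.mk (LinearMap.proj 0 : Module.Dual ℤ (Fin 2 → ℤ)) + n • Submodule.Quotient.mk (f • (LinearMap.proj 1 : Module.Dual ℤ (Fin 2 → ℤ)) - c • (LinearMap.proj 0 : Module.Dual ℤ (Fin 2 → ℤ))) := fun m n ↦ by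
    rw [hψ, AddMonoidHom.coprod_apply, hψ₁, hψ₃, ZMod.lift_coe, ZMod.lift_coe]
    rfl
  -- `ψ` is onto (generation) between sets of the same finite size, hence bijective
  have hsurj : Function.Surjective ψ := fun x ↦ by
    obtain ⟨φ, rfl⟩ := Submodule.Quotient.mk_surjective _ x
    obtain ⟨m, n, hmn⟩ := exists_mk_eq_zsmul_add_zsmul t hf ha hc hT hw φ
    exact ⟨((m : ZMod D'), (n : ZMod T')), by rw [hψ_apply, hmn]⟩
  have hcard : Nat.card (ZMod D' × ZMod T') ≤ Nat.card (Matrix.toBilin' !![-(2 * b), a; a, -(2 * t : ℤ)]).discriminantGroup := by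
    rw [Nat.card_prod, Nat.card_zmod, Nat.card_zmod, natCard_discriminantGroup_generalDivisorGram t ht hf hd hb ha hD hT,
      ← Nat.cast_mul, Int.natAbs_natCast]
  have hbij : Function.Bijective ψ := hsurj.bijective_of_nat_card_le hcard
  refine ⟨(AddEquiv.ofBijective ψ hbij).symm, ?_, ?_⟩
  · apply (AddEquiv.ofBijective ψ hbij).injective
    rw [AddEquiv.apply_symm_apply, AddEquiv.ofBijective_apply,
      show ((1, 0) : ZMod D' × ZMod T') = (((1 : ℤ) : ZMod D'), ((0 : ℤ) : ZMod T')) by push_cast; rfl, hψ_apply,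
      one_smul, zero_smul, add_zero]
  · apply (AddEquiv.ofBijective ψ hbij).injective
    rw [AddEquiv.apply_symm_apply, AddEquiv.ofBijective_apply,
      show ((0, 1) : ZMod D' × ZMod T') = (((0 : ℤ) : ZMod D'), ((1 : ℤ) : ZMod T')) by push_cast; rfl, hψ_apply,
      one_smul, zero_smul, zero_add]

end Structure

/-! ### §4 "`k̄₁·k̄₃ = 0`" and "`k̄₃² ≡ −f²/2t mod 2`": the values of the `ℚ`-valued pairing -/

section Pairing

variable (t : ℕ)

/-- `B = (−2b, a; a, −2t)` is symmetric. [cite: GritsenkoHulekSankaran2010Symplectic, §4 Prop. 4.6 (iv)] -/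
theorem isSymm_toBilin'_generalDivisorGram (b a : ℤ) : (Matrix.toBilin' !![-(2 * b), a; a, -(2 * t : ℤ)]).IsSymm :=
  ⟨fun x y ↦ by rw [toBilin'_generalDivisorGram_apply, toBilin'_generalDivisorGram_apply]; ring⟩

/-- `B = (−2b, a; a, −2t)` is even. [cite: GritsenkoHulekSankaran2010Symplectic, §4 Prop. 4.6 (iv)] -/
theorem isEven_toBilin'_generalDivisorGram (b a : ℤ) : (Matrix.toBilin' !![-(2 * b), a; a, -(2 * t : ℤ)]).IsEven := fun v ↦
  ⟨-(b * v 0 ^ 2) + a * (v 0 * v 1) - t * v 1 ^ 2, by rw [toBilin'_generalDivisorGram_apply]; ring⟩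

/-- `B` is nondegenerate when `d ≠ 0` (`det B = 4dt/f² ≠ 0`). [cite: GritsenkoHulekSankaran2010Symplectic, §4 Prop. 4.6 (iv)] -/
theorem nondegenerate_toBilin'_generalDivisorGram (ht : 0 < t) {f b c a d : ℤ} (hd : d ≠ 0)
    (hb : f ^ 2 * b = d + t * c ^ 2) (ha : f * a = 2 * t * c) : (Matrix.toBilin' !![-(2 * b), a; a, -(2 * t : ℤ)]).Nondegenerate := by
  refine LinearMap.BilinForm.nondegenerate_toBilin'_iff_det_ne_zero.2 fun h0 ↦ ?_
  have h1 := det_generalDivisorGram_mul_sq t hb ha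
  rw [h0, zero_mul] at h1
  have : (4 * d * t : ℤ) ≠ 0 := by positivity
  exact this h1.symm

/-- `i_B(−f, −c) = (2d/f)·ε₀`: a denominator for `k̄₁`. [cite: GritsenkoHulekSankaran2010Symplectic, §4 proof of Prop. 4.12 ("`k₁ = (f/2d)h_d − e₂`")] -/
theorem toBilin'_generalDivisorGram_neg_eq_smul_proj {f b c a d D' : ℤ} (hf : f ≠ 0) (hb : f ^ 2 * b = d + t * c ^ 2)
    (ha : f * a = 2 * t * c) (hD : f * D' = 2 * d) : (Matrix.toBilin' !![-(2 * b), a; a, -(2 * t : ℤ)]) ![-f, -c] = D' • (LinearMap.proj 0 : Module.Dual ℤ (Fin 2 → ℤ)) := by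
  have hkey : a * c - 2 * b * f = -D' := by
    apply mul_left_cancel₀ hf
    linear_combination c * ha - 2 * hb + hD
  rw [toBilin'_generalDivisorGram_vecCons, show a * -f - 2 * t * -c = 0 by linear_combination -ha, zero_smul, add_zero,
    show -(2 * b) * -f + a * -c = D' by linear_combination -hkey]

/-- `i_B(0, −1) = (2t/f)·(fε₁ − cε₀)`: a denominator for `k̄₃`. [cite: GritsenkoHulekSankaran2010Symplectic, §4 proof of Prop. 4.12 ("`k₃ = ce₂ + (f/2t)l_t`")] -/
theorem toBilin'_generalDivisorGram_eq_smul_sub {f c a T' : ℤ} (b : ℤ) (hf : f ≠ 0) (ha : f * a = 2 * t * c)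
    (hT : f * T' = 2 * t) : (Matrix.toBilin' !![-(2 * b), a; a, -(2 * t : ℤ)]) ![0, -1] = T' • (f • (LinearMap.proj 1 : Module.Dual ℤ (Fin 2 → ℤ)) - c • (LinearMap.proj 0 : Module.Dual ℤ (Fin 2 → ℤ))) := by
  have haT : a = c * T' := by
    apply mul_left_cancel₀ hf
    linear_combination ha - c * hT
  rw [toBilin'_generalDivisorGram_vecCons, haT, ← hT]
  module

/-- **"`k̄₁·k̄₃ = 0`"**: the `ℚ`-valued pairing of `k₁ = ε₀` and `k₃ = fε₁ − cε₀` is exactly `0` (so `b_{D(L_B)}(k̄₁, k̄₃) = 0`;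
`f²b = d + tc²`, `fa = 2tc`, `fD' = 2d`, `f, d ≠ 0`, `t ≥ 1`). [cite: GritsenkoHulekSankaran2010Symplectic, §4 proof of Prop. 4.12 ("Moreover `k̄₁·k̄₃ = 0`")] -/
theorem dualForm_proj_zero_sub_eq_zero (ht : 0 < t) {f b c a d D' : ℤ} (hf : f ≠ 0) (hd : d ≠ 0)
    (hb : f ^ 2 * b = d + t * c ^ 2) (ha : f * a = 2 * t * c) (hD : f * D' = 2 * d) :
    (Matrix.toBilin' !![-(2 * b), a; a, -(2 * t : ℤ)]).dualForm (LinearMap.proj 0 : Module.Dual ℤ (Fin 2 → ℤ)) (f • (LinearMap.proj 1 : Module.Dual ℤ (Fin 2 → ℤ)) - c • (LinearMap.proj 0 : Module.Dual ℤ (Fin 2 → ℤ))) = 0 := by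
  have hD0 : D' ≠ 0 := by
    rintro rfl
    rw [mul_zero] at hD
    omega
  rw [dualForm_eq_div_of_apply_eq_smul _ (nondegenerate_toBilin'_generalDivisorGram t ht hd hb ha) hD0
    (toBilin'_generalDivisorGram_neg_eq_smul_proj t hf hb ha hD) (f • (LinearMap.proj 1 : Module.Dual ℤ (Fin 2 → ℤ)) - c • (LinearMap.proj 0 : Module.Dual ℤ (Fin 2 → ℤ)))]
  simp only [LinearMap.sub_apply, LinearMap.smul_apply, LinearMap.coe_proj, Function.eval, smul_eq_mul,
    Matrix.cons_val_zero, Matrix.cons_val_one]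
  push_cast
  ring

/-- **"`k̄₁·k̄₃ = 0`" in `D(L_B)`**: `b_{D(L_B)}([ε₀], [fε₁ − cε₀]) = 0`. [cite: GritsenkoHulekSankaran2010Symplectic, §4 proof of Prop. 4.12] -/
theorem discriminantBilin_mk_proj_zero_mk_sub_eq_zero (ht : 0 < t) {f b c a d D' : ℤ} (hf : f ≠ 0) (hd : d ≠ 0)
    (hb : f ^ 2 * b = d + t * c ^ 2) (ha : f * a = 2 * t * c) (hD : f * D' = 2 * d) :
    (Matrix.toBilin' !![-(2 * b), a; a, -(2 * t : ℤ)]).discriminantBilin (nondegenerate_toBilin'_generalDivisorGram t ht hd hb ha)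
        (isSymm_toBilin'_generalDivisorGram t b a) (Submodule.Quotient.mk (LinearMap.proj 0 : Module.Dual ℤ (Fin 2 → ℤ))) (Submodule.Quotient.mk (f • (LinearMap.proj 1 : Module.Dual ℤ (Fin 2 → ℤ)) - c • (LinearMap.proj 0 : Module.Dual ℤ (Fin 2 → ℤ)))) = 0 := by
  rw [discriminantBilin_mk_mk, dualForm_proj_zero_sub_eq_zero t ht hf hd hb ha hD, AddCircle.coe_zero]

/-- **"`k̄₃² ≡ −f²/2t mod 2`"**: the `ℚ`-valued square of `k₃ = fε₁ − cε₀` is `−f/T' = −f²/2t` (`fT' = 2t`, `fa = 2tc`, `f, d ≠ 0`).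
[cite: GritsenkoHulekSankaran2010Symplectic, §4 proof of Prop. 4.12 ("`k̄₃² ≡ −f²/2t mod 2`")] -/
theorem dualForm_sub_sub_eq (ht : 0 < t) {f b c a d T' : ℤ} (hf : f ≠ 0) (hd : d ≠ 0) (hb : f ^ 2 * b = d + t * c ^ 2)
    (ha : f * a = 2 * t * c) (hT : f * T' = 2 * t) :
    (Matrix.toBilin' !![-(2 * b), a; a, -(2 * t : ℤ)]).dualForm (f • (LinearMap.proj 1 : Module.Dual ℤ (Fin 2 → ℤ)) - c • (LinearMap.proj 0 : Module.Dual ℤ (Fin 2 → ℤ))) (f • (LinearMap.proj 1 : Module.Dual ℤ (Fin 2 → ℤ)) - c • (LinearMap.proj 0 : Module.Dual ℤ (Fin 2 → ℤ))) = -(f : ℚ) ^ 2 / (2 * t) := by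
  have hT0 : T' ≠ 0 := by
    rintro rfl
    rw [mul_zero] at hT
    omega
  rw [dualForm_eq_div_of_apply_eq_smul _ (nondegenerate_toBilin'_generalDivisorGram t ht hd hb ha) hT0
    (toBilin'_generalDivisorGram_eq_smul_sub t b hf ha hT) (f • (LinearMap.proj 1 : Module.Dual ℤ (Fin 2 → ℤ)) - c • (LinearMap.proj 0 : Module.Dual ℤ (Fin 2 → ℤ)))]
  simp only [LinearMap.sub_apply, LinearMap.smul_apply, LinearMap.coe_proj, Function.eval, smul_eq_mul,
    Matrix.cons_val_zero, Matrix.cons_val_one]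
  have hT' : (T' : ℚ) ≠ 0 := by exact_mod_cast hT0
  have ht' : (2 * t : ℚ) ≠ 0 := by positivity
  rw [div_eq_div_iff hT' ht']
  have hTq : (f : ℚ) * T' = 2 * t := by exact_mod_cast hT
  push_cast
  linear_combination f * hTq

/-- **`q_{D(L_B)}(k̄₃) = −f²/2t mod 2ℤ`** for `k̄₃ = [fε₁ − cε₀]` (`B` is even). [cite: GritsenkoHulekSankaran2010Symplectic, §4 proof of Prop. 4.12 ("`k̄₃² ≡ −f²/2t mod 2`")] -/
theorem discriminantQuad_mk_sub_eq (ht : 0 < t) {f b c a d T' : ℤ} (hf : f ≠ 0) (hd : d ≠ 0)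
    (hb : f ^ 2 * b = d + t * c ^ 2) (ha : f * a = 2 * t * c) (hT : f * T' = 2 * t) :
    (Matrix.toBilin' !![-(2 * b), a; a, -(2 * t : ℤ)]).discriminantQuad (nondegenerate_toBilin'_generalDivisorGram t ht hd hb ha)
        (isSymm_toBilin'_generalDivisorGram t b a) (isEven_toBilin'_generalDivisorGram t b a) (Submodule.Quotient.mk (f • (LinearMap.proj 1 : Module.Dual ℤ (Fin 2 → ℤ)) - c • (LinearMap.proj 0 : Module.Dual ℤ (Fin 2 → ℤ)))) =
      ((-(f : ℚ) ^ 2 / (2 * t) : ℚ) : AddCircle (2 : ℚ)) := by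
  rw [discriminantQuad_mk, dualForm_sub_sub_eq t ht hf hd hb ha hT]

/-- **`k̄₁² = −f²/2d`**: the `ℚ`-valued square of `k₁ = ε₀` is `−f/D' = −f²/2d` (`fD' = 2d`).
[cite: GritsenkoHulekSankaran2010Symplectic, §4 proof of Prop. 4.12 (the dual basis `k₁, k₂` of `L_B^∨`)] -/
theorem dualForm_proj_zero_proj_zero_eq (ht : 0 < t) {f b c a d D' : ℤ} (hf : f ≠ 0) (hd : d ≠ 0)
    (hb : f ^ 2 * b = d + t * c ^ 2) (ha : f * a = 2 * t * c) (hD : f * D' = 2 * d) :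
    (Matrix.toBilin' !![-(2 * b), a; a, -(2 * t : ℤ)]).dualForm (LinearMap.proj 0 : Module.Dual ℤ (Fin 2 → ℤ)) (LinearMap.proj 0 : Module.Dual ℤ (Fin 2 → ℤ)) = -(f : ℚ) ^ 2 / (2 * d) := by
  have hD0 : D' ≠ 0 := by
    rintro rfl
    rw [mul_zero] at hD
    omega
  rw [dualForm_eq_div_of_apply_eq_smul _ (nondegenerate_toBilin'_generalDivisorGram t ht hd hb ha) hD0
    (toBilin'_generalDivisorGram_neg_eq_smul_proj t hf hb ha hD) (LinearMap.proj 0 : Module.Dual ℤ (Fin 2 → ℤ))]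
  simp only [LinearMap.coe_proj, Function.eval, Matrix.cons_val_zero]
  have hD'q : (D' : ℚ) ≠ 0 := by exact_mod_cast hD0
  have hdq : (2 * d : ℚ) ≠ 0 := by
    have : (d : ℚ) ≠ 0 := by exact_mod_cast hd
    positivity
  rw [div_eq_div_iff hD'q hdq]
  have hDq : (f : ℚ) * D' = 2 * d := by exact_mod_cast hD
  push_cast
  linear_combination f * hDq

end Pairing

end Literature.Topology.FourManifolds
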